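import Summits.AtomisticToContinuum.Crystallization.Theorems.HullExactificationCascadeRobustBarlowTemplateHoneycombSkew

/-!
# Honeycomb lemmas, part 2a (the closed-prism formula and the six cells) for line `registered` (crux `RobustBarlowTemplate`, stmt-AtomisticToContinuum-12088)

Toward the registered stub `develop_injective`: the CONFORMITY of the refined Barlow honeycomb
(definitions in `…HoneycombDefs.lean`, skew-coordinate algebra in `…HoneycombSkew.lean`).  The point
location `plData` uses half-open conventions (`⌊·⌋`, strict/non-strict sign tests); here we show that
the resulting piecewise-affine extension `plExtend s g` is nevertheless given, on every CLOSED prism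
`[i, i+1] × [j, j+1] × [0, 1]` of every slab `k` (in the skew coordinates of that slab), by the single
six-branch formula of `plData` — i.e. the formulas of neighbouring prisms agree on common faces,
including across the layer `k + 1`, where the frames of slabs `k` and `k + 1` differ (letters
`σ_k`, `σ_{k+1}`; for `σ_k ≠ σ_{k+1}` the two induced triangulations of the layer are related by the
point reflection `(α, β) ↦ (-α, -β)`, which preserves the triangulation of the triangular lattice by
its three line families) — and then that on each of the six CLOSED cells of a prism (`T↑`, `T↓` and
the four quarter-octahedra around the diagonal `C–D`) it is one affine formula.

## Contents
* `honeycomb_plExtend_ofSkew` — `plExtend` at `ofSkew s k c`, `0 ≤ θ < 1`, given `⌊α⌋, ⌊β⌋`;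
* `honeycomb_plExtend_prism` — THE CLOSED-PRISM FORMULA (faces `a = 1`, `b = 1`: neighbouring prisms;
  face `θ = 1`: slab `k + 1`, both letters);
* `honeycomb_plExtend_cellUp/Down/AB/EA/BF/FE` — the affine formula on each closed cell;
* `honeycomb_plExtend_tetUp` — registered anchor (`E3`-valued data, cell `T↑`).

Proof technique: after unfolding, every face identity is an equality of two `ℝ`-linear combinations
of values `g (site)`; `ring_nf` normalises the site index triples, `match_scalars` reduces to the
scalar coefficients, which are affine identities in `(a, b, θ)` on the face, closed by `linarith`.
-/

noncomputable section

namespace Summit.AtomisticToContinuum.Crystallization.Theorems.HullExactificationCascadeRobustBarlowTemplate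

open Literature.MathematicalPhysics.StatisticalMechanics

/-- Euclidean `3`-space. -/
local notation "E3" => EuclideanSpace ℝ (Fin 3)

/-! ## `plExtend` in skew coordinates -/

/-- `plExtend` at a point of slab `k` with skew coordinates `c` (`0 ≤ θ < 1`), given the integer
parts `i = ⌊α⌋`, `j = ⌊β⌋`: the six-branch formula of `plData`, summed. -/
theorem honeycomb_plExtend_ofSkew {W : Type*} [AddCommGroup W] [Module ℝ W] {s : ℤ → ℤ} {k : ℤ}
    (hsk : s k = 1 ∨ s k = -1) (g : ℤ × ℤ × ℤ → W) (c : Fin 3 → ℝ) (i j : ℤ)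
    (hi : ⌊c 0⌋ = i) (hj : ⌊c 1⌋ = j) (h0 : 0 ≤ c 2) (h1 : c 2 < 1) :
    plExtend s g (ofSkew s k c) =
      (let a : ℝ := c 0 - i
      let b : ℝ := c 1 - j
      let θ : ℝ := c 2
      let v : ℤ → ℤ → ℤ → ℤ × ℤ × ℤ := fun p q r => skewSite s k (i + p) (j + q) r
      if a + b + θ ≤ 1 then
        (1 - a - b - θ) • g (v 0 0 0) + a • g (v 1 0 0) + b • g (v 0 1 0) + θ • g (v 0 0 1)
      else if 2 ≤ a + b + θ then
        (1 - θ) • g (v 1 1 0) + (1 - b) • g (v 1 0 1) + (1 - a) • g (v 0 1 1) + (a + b + θ - 2) • g (v 1 1 1)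
      else if b + θ ≤ 1 then
        (if a + θ ≤ 1 then
          (a + b + θ - 1) • g (v 1 1 0) + θ • g (v 0 0 1) + (1 - b - θ) • g (v 1 0 0) + (1 - a - θ) • g (v 0 1 0)
        else
          b • g (v 1 1 0) + (1 - a) • g (v 0 0 1) + (a + θ - 1) • g (v 1 0 1) + (1 - b - θ) • g (v 1 0 0))
      else
        (if a + θ ≤ 1 then
          a • g (v 1 1 0) + (1 - b) • g (v 0 0 1) + (1 - a - θ) • g (v 0 1 0) + (b + θ - 1) • g (v 0 1 1)
        else
          (1 - θ) • g (v 1 1 0) + (2 - a - b - θ) • g (v 0 0 1) + (b + θ - 1) • g (v 0 1 1) +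
            (a + θ - 1) • g (v 1 0 1))) := by
  subst hi hj
  rw [plExtend, honeycomb_plData_ofSkew hsk c h0 h1]
  simp only []
  split_ifs <;> simp [Fin.sum_univ_four, Matrix.cons_val_two, Matrix.cons_val_three, Matrix.vecHead, Matrix.vecTail]

/-! ## The closed-prism formula -/

/-- `⌊n + t⌋ = n` for `0 ≤ t < 1`. -/
theorem honeycomb_floor_intCast_add {n : ℤ} {t : ℝ} (h0 : 0 ≤ t) (h1 : t < 1) :
    ⌊(n : ℝ) + t⌋ = n := by
  rw [Int.floor_eq_iff]; constructor <;> linarith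

/-- `⌊t⌋ = n` from `n ≤ t < n + 1`. -/
theorem honeycomb_floor_eq {n : ℤ} {t : ℝ} (h0 : (n : ℝ) ≤ t) (h1 : t < n + 1) : ⌊t⌋ = n :=
  Int.floor_eq_iff.2 ⟨h0, h1⟩

/-- `⌊n + 1⌋ = n + 1`. -/
theorem honeycomb_floor_intCast_add_one (n : ℤ) : ⌊(n : ℝ) + 1⌋ = n + 1 := by
  rw [Int.floor_intCast_add, Int.floor_one]

set_option maxHeartbeats 1000000 in -- several hundred `split_ifs` leaves closed by `linarith`
/-- THE CLOSED-PRISM FORMULA: on the CLOSED prism `[i, i+1] × [j, j+1] × [0, 1]` of slab `k` (skew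
coordinates `(i + a, j + b, θ)`, `a, b, θ ∈ [0, 1]`) the piecewise-affine extension is given by the
six-branch formula of `plData` in `(a, b, θ)` — including on the faces `a = 1`, `b = 1` (which
`plData` assigns to the neighbouring prisms) and `θ = 1` (assigned to slab `k + 1`, whose frame is
different).  This is the conformity of the refined honeycomb across prism faces. -/
theorem honeycomb_plExtend_prism {W : Type*} [AddCommGroup W] [Module ℝ W] {s : ℤ → ℤ}
    (hs : IsHaggSeq s) (g : ℤ × ℤ × ℤ → W) (k i j : ℤ) (a b θ : ℝ)
    (ha0 : 0 ≤ a) (ha1 : a ≤ 1) (hb0 : 0 ≤ b) (hb1 : b ≤ 1) (hθ0 : 0 ≤ θ) (hθ1 : θ ≤ 1) :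
    plExtend s g (ofSkew s k ![(i : ℝ) + a, (j : ℝ) + b, θ]) =
      (let v : ℤ → ℤ → ℤ → ℤ × ℤ × ℤ := fun p q r => skewSite s k (i + p) (j + q) r
      if a + b + θ ≤ 1 then
        (1 - a - b - θ) • g (v 0 0 0) + a • g (v 1 0 0) + b • g (v 0 1 0) + θ • g (v 0 0 1)
      else if 2 ≤ a + b + θ then
        (1 - θ) • g (v 1 1 0) + (1 - b) • g (v 1 0 1) + (1 - a) • g (v 0 1 1) + (a + b + θ - 2) • g (v 1 1 1)
      else if b + θ ≤ 1 then
        (if a + θ ≤ 1 then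
          (a + b + θ - 1) • g (v 1 1 0) + θ • g (v 0 0 1) + (1 - b - θ) • g (v 1 0 0) + (1 - a - θ) • g (v 0 1 0)
        else
          b • g (v 1 1 0) + (1 - a) • g (v 0 0 1) + (a + θ - 1) • g (v 1 0 1) + (1 - b - θ) • g (v 1 0 0))
      else
        (if a + θ ≤ 1 then
          a • g (v 1 1 0) + (1 - b) • g (v 0 0 1) + (1 - a - θ) • g (v 0 1 0) + (b + θ - 1) • g (v 0 1 1)
        else
          (1 - θ) • g (v 1 1 0) + (2 - a - b - θ) • g (v 0 0 1) + (b + θ - 1) • g (v 0 1 1) +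
            (a + θ - 1) • g (v 1 0 1))) := by
  have hsk := hs k
  rcases hθ1.lt_or_eq with hθ1 | rfl
  · -- `θ < 1`: the point lies in slab `k`
    rcases ha1.lt_or_eq with ha1 | rfl <;> rcases hb1.lt_or_eq with hb1 | rfl
    · -- interior prism: the formula is `plData` itself
      rw [honeycomb_plExtend_ofSkew hsk g ![(i : ℝ) + a, (j : ℝ) + b, θ] i j
        (honeycomb_floor_intCast_add ha0 ha1) (honeycomb_floor_intCast_add hb0 hb1) hθ0 hθ1]
      simp only [Matrix.cons_val_zero, Matrix.cons_val_one, Matrix.cons_val, add_sub_cancel_left]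
    · -- face `b = 1`: prism `(i, j+1)` with `b' = 0`
      rw [honeycomb_plExtend_ofSkew hsk g ![(i : ℝ) + a, (j : ℝ) + 1, θ] i (j + 1)
        (honeycomb_floor_intCast_add ha0 ha1) (honeycomb_floor_intCast_add_one j) hθ0 hθ1]
      simp only [Matrix.cons_val_zero, Matrix.cons_val_one, Matrix.cons_val, add_sub_cancel_left,
        Int.cast_add, Int.cast_one, sub_self]
      split_ifs <;> first
        | (exfalso; linarith)
        | (simp only [skewSite]; done)
        | (simp only [skewSite]; ring_nf; done)
        | (simp only [skewSite]; (try ring_nf); match_scalars <;> linarith)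
    · -- face `a = 1`
      rw [honeycomb_plExtend_ofSkew hsk g ![(i : ℝ) + 1, (j : ℝ) + b, θ] (i + 1) j
        (honeycomb_floor_intCast_add_one i) (honeycomb_floor_intCast_add hb0 hb1) hθ0 hθ1]
      simp only [Matrix.cons_val_zero, Matrix.cons_val_one, Matrix.cons_val, add_sub_cancel_left,
        Int.cast_add, Int.cast_one, sub_self]
      split_ifs <;> first
        | (exfalso; linarith)
        | (simp only [skewSite]; done)
        | (simp only [skewSite]; ring_nf; done)
        | (simp only [skewSite]; (try ring_nf); match_scalars <;> linarith)
    · -- edge `a = b = 1`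
      rw [honeycomb_plExtend_ofSkew hsk g ![(i : ℝ) + 1, (j : ℝ) + 1, θ] (i + 1) (j + 1)
        (honeycomb_floor_intCast_add_one i) (honeycomb_floor_intCast_add_one j) hθ0 hθ1]
      simp only [Matrix.cons_val_zero, Matrix.cons_val_one, Matrix.cons_val, add_sub_cancel_left,
        Int.cast_add, Int.cast_one, sub_self]
      split_ifs <;> first
        | (exfalso; linarith)
        | (simp only [skewSite]; done)
        | (simp only [skewSite]; ring_nf; done)
        | (simp only [skewSite]; (try ring_nf); match_scalars <;> linarith)
  · -- `θ = 1`: the point lies in slab `k + 1`; both sides are the planar interpolation on layer `k + 1`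
    rw [honeycomb_ofSkew_top s k (hs (k + 1))]
    have hk := hs (k + 1)
    trans (let v : ℤ → ℤ → ℤ → ℤ × ℤ × ℤ := fun p q r => skewSite s k (i + p) (j + q) r
      if a + b ≤ 1 then (1 - a - b) • g (v 0 0 1) + a • g (v 1 0 1) + b • g (v 0 1 1)
      else (a + b - 1) • g (v 1 1 1) + (1 - b) • g (v 1 0 1) + (1 - a) • g (v 0 1 1))
    · obtain ⟨hτ, hkk⟩ | ⟨hτ, hkk⟩ : ((s k : ℝ) * (s (k + 1) : ℝ) = 1 ∧ s k = s (k + 1)) ∨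
          ((s k : ℝ) * (s (k + 1) : ℝ) = -1 ∧ s k = -s (k + 1)) := by
        rcases hs k with h | h <;> rcases hs (k + 1) with h' | h' <;> simp [h, h']
      · -- `τ = 1`: same triangulation indices
        simp only [hτ, one_mul]
        rcases ha1.lt_or_eq with ha1 | rfl <;> rcases hb1.lt_or_eq with hb1 | rfl <;>
        first
          | rw [honeycomb_plExtend_ofSkew hk g ![(i : ℝ) + a, (j : ℝ) + b, 0] i j
              (honeycomb_floor_intCast_add ha0 ha1) (honeycomb_floor_intCast_add hb0 hb1) le_rfl zero_lt_one]
          | rw [honeycomb_plExtend_ofSkew hk g ![(i : ℝ) + a, (j : ℝ) + 1, 0] i (j + 1)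
              (honeycomb_floor_intCast_add ha0 ha1) (honeycomb_floor_intCast_add_one j) le_rfl zero_lt_one]
          | rw [honeycomb_plExtend_ofSkew hk g ![(i : ℝ) + 1, (j : ℝ) + b, 0] (i + 1) j
              (honeycomb_floor_intCast_add_one i) (honeycomb_floor_intCast_add hb0 hb1) le_rfl zero_lt_one]
          | rw [honeycomb_plExtend_ofSkew hk g ![(i : ℝ) + 1, (j : ℝ) + 1, 0] (i + 1) (j + 1)
              (honeycomb_floor_intCast_add_one i) (honeycomb_floor_intCast_add_one j) le_rfl zero_lt_one]
        all_goals
          simp only [Matrix.cons_val_zero, Matrix.cons_val_one, Matrix.cons_val, add_sub_cancel_left,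
            Int.cast_add, Int.cast_one, sub_self]
          split_ifs <;> first
            | (exfalso; linarith)
            | (simp only [skewSite, hkk]; done)
            | (simp only [skewSite, hkk]; ring_nf; done)
            | (simp only [skewSite, hkk]; (try ring_nf); match_scalars <;> linarith)
      · -- `τ = -1`: point-reflected triangulation indices
        simp only [hτ, neg_one_mul]
        rcases ha0.eq_or_lt with rfl | ha0 <;> rcases hb0.eq_or_lt with rfl | hb0 <;>
        first
          | rw [honeycomb_plExtend_ofSkew hk g ![-((i : ℝ) + 0), -((j : ℝ) + 0), 0] (-i) (-j)
              (honeycomb_floor_eq (by push_cast; linarith) (by push_cast; linarith))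
              (honeycomb_floor_eq (by push_cast; linarith) (by push_cast; linarith)) le_rfl zero_lt_one]
          | rw [honeycomb_plExtend_ofSkew hk g ![-((i : ℝ) + 0), -((j : ℝ) + b), 0] (-i) (-j - 1)
              (honeycomb_floor_eq (by push_cast; linarith) (by push_cast; linarith))
              (honeycomb_floor_eq (by push_cast; linarith) (by push_cast; linarith)) le_rfl zero_lt_one]
          | rw [honeycomb_plExtend_ofSkew hk g ![-((i : ℝ) + a), -((j : ℝ) + 0), 0] (-i - 1) (-j)
              (honeycomb_floor_eq (by push_cast; linarith) (by push_cast; linarith))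
              (honeycomb_floor_eq (by push_cast; linarith) (by push_cast; linarith)) le_rfl zero_lt_one]
          | rw [honeycomb_plExtend_ofSkew hk g ![-((i : ℝ) + a), -((j : ℝ) + b), 0] (-i - 1) (-j - 1)
              (honeycomb_floor_eq (by push_cast; linarith) (by push_cast; linarith))
              (honeycomb_floor_eq (by push_cast; linarith) (by push_cast; linarith)) le_rfl zero_lt_one]
        all_goals
          simp only [Matrix.cons_val_zero, Matrix.cons_val_one, Matrix.cons_val]
          push_cast
          split_ifs <;> first
            | (exfalso; linarith)
            | (simp only [skewSite, hkk]; done)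
            | (simp only [skewSite, hkk]; ring_nf; done)
            | (simp only [skewSite, hkk]; (try ring_nf); match_scalars <;> linarith)
    · simp only []
      split_ifs <;> first
        | (exfalso; linarith)
        | (simp only [skewSite]; done)
        | (simp only [skewSite]; ring_nf; done)
        | (simp only [skewSite]; (try ring_nf); match_scalars <;> linarith)

/-! ## The six closed cells of a prism

On each CLOSED cell of the prism (the tetrahedra `T↑`, `T↓` and the four quarter-octahedra around
the diagonal `C–D`) the extension is ONE affine formula in the local skew coordinates; the cells are
given by non-strict sign conditions, so adjacent cells overlap in common faces, where the formulas
agree. -/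

/-- Cell `T↑ = {(0,0,0), (1,0,0), (0,1,0), (0,0,1)}`: `a, b, θ ≥ 0`, `a + b + θ ≤ 1`. -/
theorem honeycomb_plExtend_cellUp {W : Type*} [AddCommGroup W] [Module ℝ W] {s : ℤ → ℤ}
    (hs : IsHaggSeq s) (g : ℤ × ℤ × ℤ → W) (k i j : ℤ) (a b θ : ℝ)
    (ha : 0 ≤ a) (hb : 0 ≤ b) (hθ : 0 ≤ θ) (h1 : a + b + θ ≤ 1) :
    plExtend s g (ofSkew s k ![(i : ℝ) + a, (j : ℝ) + b, θ]) =
      (1 - a - b - θ) • g (skewSite s k i j 0) + a • g (skewSite s k (i + 1) j 0) +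
        b • g (skewSite s k i (j + 1) 0) + θ • g (skewSite s k i j 1) := by
  rw [honeycomb_plExtend_prism hs g k i j a b θ ha (by linarith) hb (by linarith) hθ (by linarith)]
  simp only [skewSite, add_zero, mul_add, mul_one, h1, ↓reduceIte]

/-- Cell `T↓ = {(1,1,0), (1,0,1), (0,1,1), (1,1,1)}`: `a, b, θ ≤ 1`, `2 ≤ a + b + θ`. -/
theorem honeycomb_plExtend_cellDown {W : Type*} [AddCommGroup W] [Module ℝ W] {s : ℤ → ℤ}
    (hs : IsHaggSeq s) (g : ℤ × ℤ × ℤ → W) (k i j : ℤ) (a b θ : ℝ)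
    (ha : a ≤ 1) (hb : b ≤ 1) (hθ : θ ≤ 1) (h2 : 2 ≤ a + b + θ) :
    plExtend s g (ofSkew s k ![(i : ℝ) + a, (j : ℝ) + b, θ]) =
      (1 - θ) • g (skewSite s k (i + 1) (j + 1) 0) + (1 - b) • g (skewSite s k (i + 1) j 1) +
        (1 - a) • g (skewSite s k i (j + 1) 1) + (a + b + θ - 2) • g (skewSite s k (i + 1) (j + 1) 1) := by
  rw [honeycomb_plExtend_prism hs g k i j a b θ (by linarith) ha (by linarith) hb (by linarith) hθ]
  have hc1 : ¬ (a + b + θ ≤ 1) := not_le.2 (by linarith)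
  simp only [skewSite, add_zero, mul_add, mul_one, hc1, h2, ↓reduceIte]

/-- Quarter `{C, D, A, B}` (`C = (1,1,0)`, `D = (0,0,1)`, `A = (1,0,0)`, `B = (0,1,0)`):
`θ ≥ 0`, `1 ≤ a + b + θ`, `b + θ ≤ 1`, `a + θ ≤ 1`. -/
theorem honeycomb_plExtend_cellAB {W : Type*} [AddCommGroup W] [Module ℝ W] {s : ℤ → ℤ}
    (hs : IsHaggSeq s) (g : ℤ × ℤ × ℤ → W) (k i j : ℤ) (a b θ : ℝ)
    (hθ : 0 ≤ θ) (h1 : 1 ≤ a + b + θ) (hbθ : b + θ ≤ 1) (haθ : a + θ ≤ 1) :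
    plExtend s g (ofSkew s k ![(i : ℝ) + a, (j : ℝ) + b, θ]) =
      (a + b + θ - 1) • g (skewSite s k (i + 1) (j + 1) 0) + θ • g (skewSite s k i j 1) +
        (1 - b - θ) • g (skewSite s k (i + 1) j 0) + (1 - a - θ) • g (skewSite s k i (j + 1) 0) := by
  rw [honeycomb_plExtend_prism hs g k i j a b θ (by linarith) (by linarith) (by linarith) (by linarith)
    hθ (by linarith)]
  simp only [skewSite, add_zero, mul_add, mul_one, hbθ, haθ, ↓reduceIte]
  split_ifs with h_1 h_2
  · match_scalars <;> linarith
  · match_scalars <;> linarith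
  · rfl

/-- Quarter `{C, D, E, A}` (`E = (1,0,1)`): `b ≥ 0`, `a ≤ 1`, `b + θ ≤ 1`, `1 ≤ a + θ`. -/
theorem honeycomb_plExtend_cellEA {W : Type*} [AddCommGroup W] [Module ℝ W] {s : ℤ → ℤ}
    (hs : IsHaggSeq s) (g : ℤ × ℤ × ℤ → W) (k i j : ℤ) (a b θ : ℝ)
    (hb : 0 ≤ b) (ha : a ≤ 1) (hbθ : b + θ ≤ 1) (haθ : 1 ≤ a + θ) :
    plExtend s g (ofSkew s k ![(i : ℝ) + a, (j : ℝ) + b, θ]) =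
      b • g (skewSite s k (i + 1) (j + 1) 0) + (1 - a) • g (skewSite s k i j 1) +
        (a + θ - 1) • g (skewSite s k (i + 1) j 1) + (1 - b - θ) • g (skewSite s k (i + 1) j 0) := by
  rw [honeycomb_plExtend_prism hs g k i j a b θ (by linarith) ha hb (by linarith) (by linarith)
    (by linarith)]
  simp only [skewSite, add_zero, mul_add, mul_one, hbθ, ↓reduceIte]
  split_ifs with h_1 h_2 h_3
  · match_scalars <;> linarith
  · match_scalars <;> linarith
  · match_scalars <;> linarith
  · rfl

/-- Quarter `{C, D, B, F}` (`F = (0,1,1)`): `a ≥ 0`, `b ≤ 1`, `1 ≤ b + θ`, `a + θ ≤ 1`. -/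
theorem honeycomb_plExtend_cellBF {W : Type*} [AddCommGroup W] [Module ℝ W] {s : ℤ → ℤ}
    (hs : IsHaggSeq s) (g : ℤ × ℤ × ℤ → W) (k i j : ℤ) (a b θ : ℝ)
    (ha : 0 ≤ a) (hb : b ≤ 1) (hbθ : 1 ≤ b + θ) (haθ : a + θ ≤ 1) :
    plExtend s g (ofSkew s k ![(i : ℝ) + a, (j : ℝ) + b, θ]) =
      a • g (skewSite s k (i + 1) (j + 1) 0) + (1 - b) • g (skewSite s k i j 1) +
        (1 - a - θ) • g (skewSite s k i (j + 1) 0) + (b + θ - 1) • g (skewSite s k i (j + 1) 1) := by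
  rw [honeycomb_plExtend_prism hs g k i j a b θ ha (by linarith) (by linarith) hb (by linarith)
    (by linarith)]
  simp only [skewSite, add_zero, mul_add, mul_one, haθ, ↓reduceIte]
  split_ifs with h_1 h_2 h_3
  · match_scalars <;> linarith
  · match_scalars <;> linarith
  · match_scalars <;> linarith
  · rfl

/-- Quarter `{C, D, F, E}`: `θ ≤ 1`, `a + b + θ ≤ 2`, `1 ≤ b + θ`, `1 ≤ a + θ`. -/
theorem honeycomb_plExtend_cellFE {W : Type*} [AddCommGroup W] [Module ℝ W] {s : ℤ → ℤ}
    (hs : IsHaggSeq s) (g : ℤ × ℤ × ℤ → W) (k i j : ℤ) (a b θ : ℝ)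
    (hθ : θ ≤ 1) (h2 : a + b + θ ≤ 2) (hbθ : 1 ≤ b + θ) (haθ : 1 ≤ a + θ) :
    plExtend s g (ofSkew s k ![(i : ℝ) + a, (j : ℝ) + b, θ]) =
      (1 - θ) • g (skewSite s k (i + 1) (j + 1) 0) + (2 - a - b - θ) • g (skewSite s k i j 1) +
        (b + θ - 1) • g (skewSite s k i (j + 1) 1) + (a + θ - 1) • g (skewSite s k (i + 1) j 1) := by
  rw [honeycomb_plExtend_prism hs g k i j a b θ (by linarith) (by linarith) (by linarith) (by linarith)
    (by linarith) hθ]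
  simp only [skewSite, add_zero, mul_add, mul_one]
  split_ifs with h_1 h_2 h_3 h_4 h_5
  · match_scalars <;> linarith
  · match_scalars <;> linarith
  · match_scalars <;> linarith
  · match_scalars <;> linarith
  · match_scalars <;> linarith
  · rfl

/-- SUB-GOAL (registered anchor): on the closed tetrahedron `T↑` of prism `(k, i, j)` the extension of
`E3`-valued vertex data is the barycentric combination of the four vertex values. -/
theorem honeycomb_plExtend_tetUp :
    ∀ (s : ℤ → ℤ), IsHaggSeq s → ∀ (g : ℤ × ℤ × ℤ → E3) (k i j : ℤ) (a b θ : ℝ),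
      0 ≤ a → 0 ≤ b → 0 ≤ θ → a + b + θ ≤ 1 →
        plExtend s g (ofSkew s k ![(i : ℝ) + a, (j : ℝ) + b, θ]) =
          (1 - a - b - θ) • g (skewSite s k i j 0) + a • g (skewSite s k (i + 1) j 0) +
            b • g (skewSite s k i (j + 1) 0) + θ • g (skewSite s k i j 1) :=
  fun _ hs g k i j a b θ ha hb hθ h1 => honeycomb_plExtend_cellUp hs g k i j a b θ ha hb hθ h1

end Summit.AtomisticToContinuum.Crystallization.Theorems.HullExactificationCascadeRobustBarlowTemplate

end
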